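import Summits.BirchSwinnertonDyer.BirchSwinnertonDyer.Theorems.ThetaPartnerAtTwoSignedKatoUpToAtTwoInvolChainRank
import Summits.BirchSwinnertonDyer.BirchSwinnertonDyer.Theorems.ThetaPartnerAtTwoSignedKatoUpToAtTwoKatoBKCoreKZLit
import Summits.BirchSwinnertonDyer.BirchSwinnertonDyer.Theorems.ThetaPartnerAtTwoSignedKatoUpToAtTwoOfPubKBK
import Summits.BirchSwinnertonDyer.BirchSwinnertonDyer.Theorems.ThetaPartnerAtTwoSignedKatoUpToAtTwoKatoBKBricks
import Summits.BirchSwinnertonDyer.BirchSwinnertonDyer.Theorems.ThetaPartnerAtTwoSignedKatoUpToAtTwoOfPubInv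
import Summits.BirchSwinnertonDyer.BirchSwinnertonDyer.Theorems.ThetaPartnerAtTwoSignedKatoUpToAtTwoPointsPackageTransfer
import Summits.BirchSwinnertonDyer.BirchSwinnertonDyer.Theorems.ThetaPartnerAtTwoSignedKatoUpToAtTwoLayerSideTransfer
import Summits.BirchSwinnertonDyer.BirchSwinnertonDyer.Theorems.ThetaPartnerAtTwoSignedKatoUpToAtTwoOfPubCore
import Summits.BirchSwinnertonDyer.BirchSwinnertonDyer.Theorems.ThetaPartnerAtTwoSignedKatoUpToAtTwoLayerSideNoPTOfCore
import Summits.BirchSwinnertonDyer.BirchSwinnertonDyer.Theorems.ThetaPartnerAtTwoSignedKatoUpToAtTwoLayerPTOrthFinal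
import Summits.BirchSwinnertonDyer.BirchSwinnertonDyer.Theorems.ThetaPartnerAtTwoSignedKatoUpToAtTwoCorePairCertificates
import Summits.BirchSwinnertonDyer.BirchSwinnertonDyer.Theorems.ThetaPartnerAtTwoSignedKatoUpToAtTwoKatoBKSocketKZ
import Summits.BirchSwinnertonDyer.BirchSwinnertonDyer.Theses.ResidualThetaTransportAtTwo
import Literature.NumberTheory.EllipticCurves.Kato2004.EulerSystemTatePairingValuesTwo
import Literature.NumberTheory.EllipticCurves.Kato2004.IwasawaCohomology
import Literature.NumberTheory.EllipticCurves.PAdicBSD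
import Literature.NumberTheory.EllipticCurves.AnalyticRankOrderProofs
import Literature.NumberTheory.EllipticCurves.AnalyticRankModularityProofs
import HarnessLib

/-!
# Route `ThetaPartnerAtTwo` (TP2) / `ResidualThetaTransportAtTwo` (RTT), crux K3 `SignedKatoDivisibilityUpToAtTwo`
# (stmt-BirchSwinnertonDyer-20308), line `colemanrat` v16 — THE CERTIFICATES OVER THE GZK SOCKET: K3 BY NAME ⟸
# {Kato 13.4 (2) at `2`, (RK) `rank_Λ 𝐇¹_Γ(T₂E) ≤ 1` on the habitat, Kato's `2`-adic zeta/Tate-pairing package}, and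
# its two KATO-2004-ONLY readings K3 ⟸ {Kato Thm. 13.4 (2) at `2`, Kato Cor. 14.3 at `2` (bsd.S20), Kato Thm. 12.5 (1)-package}
# and K3 ⟸ {Kato 13.4 (2) at `2`, Kato Thm. 12.4 (2), Kato 12.5 (1)-package} — no Gross–Zagier, no Kolyvagin — plus the
# `Sel_{2^∞}(E/ℚ)`-finite reading and the RTT twins

Width seat `bsd-wall-tp2-p2x-w3` g10 (cell `bsd-wall`). Companion of `…InvolChainRank` (the socket
`SignedKatoOffTwo.stub_involChainTwo_of_rankLeOne` and the suppliers of (RK)) and of the lead's `…OfPubKatoFact`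
(`KatoBK.signedKatoDivisibilityUpToAtTwo_of_kato_facts_of_gzk : 13.4(2)@2 → GZK → fact → K3`). HONEST FRAMING:
COMPOSITIONS ONLY — no definition, no named fact, no instance, no `sorry`; every theorem is CONDITIONAL and displays its
hypotheses (named Literature `def … : Prop` facts, none proved in the tree, or the explicit habitat statements (RK) /
(SEL)); nothing is closed; K3 / K3P′ are NOT settled; BSD is NOT proved by any of this.

## What is proved

* §0 `stub_involChainTwo_of_rankLeOneNewform` — the socket of `…InvolChainRank` once more, with the rank hypothesis in the
  WEAKEST habitat shape (RK⁺) «… → for the newform `f` of `W` (`IsNewformOf W f`) → ∀ I, rank_Λ I.H ≤ 1» (the newform binder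
  is in scope where the chain consumes the rank, and is what turns `r_an = 0` into `L(E, 1) ≠ 0`); proof = the landed proof of
  `stub_involChainTwo` / `stub_involChainTwo_of_rankLeOne` verbatim up to that one line.
* `signedKatoDivisibilityUpToAtTwo_of_contraFact_of_rankLeOneNewform_of_kato_tatePairing_fact` (master, over (RK⁺)) and
  `signedKatoDivisibilityUpToAtTwo_of_contraFact_of_rankLeOne_of_kato_tatePairing_fact` (over (RK), socket of `…InvolChainRank`)
  — **K3 ⟸ {13.4 (2)@2-contra, (RK⁺)/(RK), fact}**: the whole landed chain of the line with the GZK binder replaced by the rank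
  statement:
  `signedKatoDivisibilityUpToAtTwo_of_offTwo ∘ stub_involChainTwo_of_rankLeOne ∘ katoBoundTwoInv_of_contra`, the package
  (R2^ι) being produced from the fact by the line's named transforms `localRobustPackageTwoInv_of_h1SideTwoInv ∘
  h1SideTwoInv_of_layerSideTwoInv ∘ OfPubCore.layerSideTwoInv_of_ptOrth_of_noPT stub_ptOrthLayerTwo ∘
  NoPTOfCore.layerSideNoPTTwo_of_core ∘ CoreChi.core_of_corePairChi ∘ CoreChi.corePairChi_of_corePairChiPrim ∘
  corePairChiPrim_of_coreKZ_of_bricks (coreKZ_of_coreKZLit fact) (four kernel bricks)` — byte-for-byte the road of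
  `…OfPubKatoFact`, `…CorePairCertificates` §11, `…OfPubCoreOfPub`, `…OfPubCore` §3, `…OfPubLayerSide`, `…OfPubH1Side`,
  `…OfPubInv`.
* `signedKatoDivisibilityUpToAtTwo_of_kato2004_cor143_facts` — **K3 ⟸ {`Kato2004.thm13_4_two_lengthAt_fineSelmerDualContra_le_of_isEulerSystemClassTwo`,
  bsd.S20 `kato_finite_of_L_one_ne_zero W 2` (Kato Cor. 14.3 / Thm. 14.2 at the trivial character, `K = ℚ`, `p = 2`:
  `L(E,1) ≠ 0 ⇒ Sel_{2^∞}(E/ℚ)` finite), `Kato2004.exists_eulerSystem_expStar_tatePairing_values_two`}**: three named theorems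
  of ONE source (Kato, Astérisque 295), all EXISTING Literature facts, no Gross–Zagier–Kolyvagin; road: `IsNewformOf W f` ⇒
  `L(E, s)` entire (`hasEntireLFunction_of_cuspCoeff_eq`, Hecke) ⇒ (`r_an = 0 ⇔ L(E,1) ≠ 0`, `analyticRank_eq_zero_iff_holds`)
  ⇒ bsd.S20 ⇒ `Sel_{2^∞}(E/ℚ)` finite ⇒ (RK⁺) (`rank_iwasawaH1_le_one_of_finite_selmerGroupPInfty`).
* `signedKatoDivisibilityUpToAtTwo_of_kato2004_facts` — **K3 ⟸ {`Kato2004.thm13_4_two_lengthAt_fineSelmerDualContra_le_of_isEulerSystemClassTwo`,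
  `Kato2004.thm12_4`, `Kato2004.exists_eulerSystem_expStar_tatePairing_values_two`}**: Thm. 13.4 (2), Thm. 12.4 (2), Thm. 12.5 (1)
  with (8.1.3)/Ex. 13.3 read on the layer Tate pairing — again one source, all EXISTING Literature facts (`Kato2004.thm12_4` was
  typed by cell `bsd-cn100`), no Gross–Zagier–Kolyvagin. (RK) ⟸ `thm12_4` is `rank_iwasawaH1_le_one_of_thm12_4`.
* `signedKatoDivisibilityUpToAtTwo_of_contraFact_of_finiteSelmer_of_kato_tatePairing_fact` — **K3 ⟸ {13.4 (2)@2-contra,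
  (SEL) `Sel_{2^∞}(E/ℚ)` finite on the habitat, fact}**: (SEL) is what GZK supplies in analytic rank `0` and what Kato's
  Cor. 14.3 (1) asserts at `L(E, 1) ≠ 0`; (RK) ⟸ (SEL) is `rank_iwasawaH1_le_one_of_finite_selmerGroupPInfty` (Kato 14.5 (1) ⇒
  (R0) ⇒ 12.4 (2) upper half, tree theorems).
* `…_rtt_of_kato2004_cor143_facts`, `…_rtt_of_kato2004_facts` — the two Kato-only readings on the RTT decl (byte-identical bodies).
* The GZK reading of `…OfPubKatoFact` is the socket fed by `rank_iwasawaH1_le_one_of_gzk` (not re-landed).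

References: [Kato2004Asterisque] Thm. 12.4 (2) (p. 221), Thm. 12.5 (1) (pp. 221–222), Ex. 13.3 (p. 225), Thm. 13.4 (2)
(p. 226), Cor. 14.3 (1) (p. 235), Thm. 14.5 (1) (p. 236), §17.13 (p. 279); [Kobayashi2003] Thm. 6.2–6.3, (7.17)–(7.21),
Thm. 7.3, (8.23)–(8.29), Prop. 8.25; [Rubin1998Durham] §5 (2), Thm. 7.1; [GreenbergLNM1716] §1 p. 60.
-/

set_option autoImplicit false
-- the Theorems namespace of this sub repeats the summit name by design (D-0017 nested layout)
set_option linter.dupNamespace false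

noncomputable section

set_option backward.isDefEq.respectTransparency false

open scoped Classical MatrixGroups ModularForm NumberField

open CongruenceSubgroup WeierstrassCurve Field IsDedekindDomain NumberField
  Literature.NumberTheory.GaloisRepresentations
  Literature.NumberTheory.EllipticCurves Literature.NumberTheory.EllipticCurves.ModularForms
  Literature.NumberTheory.EllipticCurves.Module Literature.NumberTheory.EllipticCurves.Rank1Residual
  Literature.NumberTheory.EllipticCurves.Kobayashi2003 Literature.NumberTheory.EllipticCurves.Kato2004
  Literature.NumberTheory.EllipticCurves.Kato2004.EulerSystemValues Literature.NumberTheory.EllipticCurves.GreenbergSelmer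
  ZpExtension Summit.BirchSwinnertonDyer.Rank1Residual.Supersingular
  Summit.BirchSwinnertonDyer.BirchSwinnertonDyer.Theses.ThetaPartnerAtTwo

namespace Summit.BirchSwinnertonDyer.BirchSwinnertonDyer.Theorems.SignedKatoOffTwo

/-! ## §0 The socket once more, rank hypothesis in the weakest habitat shape (RK⁺): with the newform binder -/

/-- **(CHAIN^ι), GZK-SOCKET FORM WITH THE NEWFORM BINDER: (K2^ι) → (RK⁺) → (R2^ι) → K3's local form off `2`.** VERBATIM
`stub_involChainTwo_of_rankLeOne` (file `…InvolChainRank`) except that the rank antecedent also receives the newform: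
(RK⁺) «for every habitat `W` (non-CM, `r_an = 0`, good supersingular at `2` with `a₂ = 0`, globally minimal), the cyclotomic `κ`,
`γ`, the newform `f` of `W` and every pin `I`: `rank_Λ 𝐇¹_Γ(T₂W) ≤ 1`» — the binders in scope at the one line where the chain
consumes the rank; the newform is what makes `L(E, s)` entire, hence `r_an = 0 ⇒ L(E,1) ≠ 0`, hence lets Kato's Cor. 14.3
(bsd.S20) feed the socket (§2). Proof = the landed proof of `stub_involChainTwo` (w2 g3) with `injective_col_of_rank_le_one` /
`lengthAt_quotient_span_ne_top_of_rank_le_one`. [cite: Kobayashi2003, (7.17)–(7.21), Thm. 7.3 (pp. 12–13)]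
[cite: Kato2004Asterisque, Thm. 12.4 (2) (p. 221), Thm. 13.4 (2) (p. 226), §17.13 (p. 279)] [cite: GreenbergLNM1716, §1 p. 60] -/
theorem stub_involChainTwo_of_rankLeOneNewform :
    (∀ (W : WeierstrassCurve ℚ) [W.IsElliptic], ¬ W.HasCM →
      ∀ [ContinuousSMul ℤ_[2] (W.tateModule 2)] [Module.Free ℤ_[2] (W.tateModule 2)]
        [Module.Finite ℤ_[2] (W.tateModule 2)]
        (κ : ZpExtension ℚ 2) (γ : Field.absoluteGaloisGroup ℚ) (hκ : κ.IsCyclotomic), κ.IsTopGenerator γ →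
      ∀ (I : Kato2004.IwasawaH1Data W 2 κ γ) (Y : W.FineSelmerDualData κ γ) (s : I.H),
        (∃ (S : Set (HeightOneSpectrum (𝓞 ℚ))) (_ : S.Finite)
            (z : ∀ (k : ℕ) (r : (cyclotomicLevelsRat 2 S).Ideals),
              H1 (tateRep W 2) ((cyclotomicLevelsRat 2 S).level k r.1)),
            IsEulerSystem (cyclotomicLevelsRat 2 S) (tateRep W 2) 2 z ∧
            (∀ (k : ℕ) (r : (cyclotomicLevelsRat 2 S).Ideals),
              z k r ∈ integralH1 (tateRep W 2) 2 ((cyclotomicLevelsRat 2 S).level k r.1)) ∧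
            ∀ n : ℕ, I.proj n s =
              Kato2004.levelToLayerTwo W hκ S n (z (n + 2) (cyclotomicLevelsRat 2 S).idealOne)) →
        s ≠ 0 →
        ∀ 𝔭 : PrimeSpectrum (IwasawaAlgebra 2), 𝔭.asIdeal.height = 1 →
          PowerSeries.C (2 : ℤ_[2]) ∉ 𝔭.asIdeal →
          lengthAt (IwasawaAlgebra 2) Y.X 𝔭 ≤
            lengthAt (IwasawaAlgebra 2) (I.H ⧸ Submodule.span (IwasawaAlgebra 2) {s})
              (PrimeSpectrum.comap (IwasawaAlgebra.invol 2).toRingHom 𝔭)) →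
    (∀ (W : WeierstrassCurve ℚ) [W.IsElliptic] [W.IsGloballyMinimal],
      ¬ W.HasCM → W.analyticRank = 0 → GoodSS W 2 → W.frobeniusTrace 2 = 0 →
      ∀ [ContinuousSMul ℤ_[2] (W.tateModule 2)] (κ : ZpExtension ℚ 2) (γ : Field.absoluteGaloisGroup ℚ),
        κ.IsCyclotomic → κ.IsTopGenerator γ →
        ∀ [NeZero (W.conductorNorm ℤ)] (f : CuspForm (Gamma0 (W.conductorNorm ℤ)) 2), IsNewformOf W f →
        ∀ I : Kato2004.IwasawaH1Data W 2 κ γ, Module.rank (IwasawaAlgebra 2) I.H ≤ 1) →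
    (∀ (v : HeightOneSpectrum (𝓞 ℚ)), ((2 : ℕ) : 𝓞 ℚ) ∈ v.asIdeal →
    ∀ (W : WeierstrassCurve ℚ) [W.IsElliptic] [W.IsGloballyMinimal],
      ¬ W.HasCM → W.analyticRank = 0 → GoodSS W 2 → W.frobeniusTrace 2 = 0 →
      ∀ (κ : ZpExtension ℚ 2) (γ : Field.absoluteGaloisGroup ℚ) (hκ : κ.IsCyclotomic),
        κ.IsTopGenerator γ → IsCyclotomicVariable 2 γ →
        ∀ [NeZero (W.conductorNorm ℤ)] (f : CuspForm (Gamma0 (W.conductorNorm ℤ)) 2),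
          IsNewformOf W f → ∀ (ϖ : ℚ), (ϖ : ℝ) * W.realPeriodRat = plusPeriod f →
        ∀ (Lplus Lminus : IwasawaAlgebra 2), IsPollackPair f 2 Lplus Lminus →
        ∀ (D : SignedSelmerDualData W κ γ 1) [ContinuousSMul ℤ_[2] (W.tateModule 2)]
          [Module.Free ℤ_[2] (W.tateModule 2)] [Module.Finite ℤ_[2] (W.tateModule 2)],
          Module.IsTorsion (IwasawaAlgebra 2) D.X →
          ∀ 𝔭 : PrimeSpectrum (IwasawaAlgebra 2), 𝔭.asIdeal.height = 1 →
            PowerSeries.C (2 : ℤ_[2]) ∉ 𝔭.asIdeal →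
          ∃ (I : Kato2004.IwasawaH1Data W 2 κ γ)
            (P : Type) (_ : AddCommGroup P) (_ : _root_.Module (IwasawaAlgebra 2) P)
            (ι : P →ₗ[IwasawaAlgebra 2] IwasawaAlgebra 2) (col : I.H →ₗ[IwasawaAlgebra 2] P)
            (j : P →+ D.X) (s : I.H) (m : ℕ),
            (∀ (g : IwasawaAlgebra 2) (y : P), j (g • y) = IwasawaAlgebra.invol 2 g • j y) ∧
            (∀ y, ι y = 0 → (PowerSeries.C (2 : ℤ_[2]) : IwasawaAlgebra 2) ^ m • y = 0) ∧
            (∀ x, (PowerSeries.C (2 : ℤ_[2]) : IwasawaAlgebra 2) ^ m • j (col x) = 0) ∧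
            (∀ x : D.X,
              (∀ t : signedSelmerInfty W κ 1,
                resOfLe (W.geomPrimaryTorsion 2) (inf_le_left : κ.kerSubgroup ⊓ decomp v ≤ κ.kerSubgroup)
                  (t : W.subgroupH1 2 κ.kerSubgroup) = 0 → D.toDual x t = 0) →
              ∃ y : P, j y = (PowerSeries.C (2 : ℤ_[2]) : IwasawaAlgebra 2) ^ m • x) ∧
            Kato2004.IsEulerSystemClassTwo W hκ I s ∧
            lengthAt (IwasawaAlgebra 2) (IwasawaAlgebra 2 ⧸ Ideal.span {ι (col s)}) 𝔭 ≤
              lengthAt (IwasawaAlgebra 2) (IwasawaAlgebra 2 ⧸ Ideal.span {kobayashiL 1 Lplus Lminus}) 𝔭) →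
    (∀ (W : WeierstrassCurve ℚ) [W.IsElliptic] [W.IsGloballyMinimal],
      ¬ W.HasCM → W.analyticRank = 0 → GoodSS W 2 → W.frobeniusTrace 2 = 0 →
      ∀ (κ : ZpExtension ℚ 2) (γ : Field.absoluteGaloisGroup ℚ),
        κ.IsCyclotomic → κ.IsTopGenerator γ → IsCyclotomicVariable 2 γ →
        ∀ [NeZero (W.conductorNorm ℤ)] (f : CuspForm (Gamma0 (W.conductorNorm ℤ)) 2),
          IsNewformOf W f → ∀ (ϖ : ℚ), (ϖ : ℝ) * W.realPeriodRat = plusPeriod f →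
        ∀ (Lplus Lminus : IwasawaAlgebra 2), IsPollackPair f 2 Lplus Lminus →
        ∀ (D : SignedSelmerDualData W κ γ 1), Module.IsTorsion (IwasawaAlgebra 2) D.X →
          ∀ 𝔭 : PrimeSpectrum (IwasawaAlgebra 2), 𝔭.asIdeal.height = 1 →
            PowerSeries.C (2 : ℤ_[2]) ∉ 𝔭.asIdeal →
            lengthAt (IwasawaAlgebra 2) D.X 𝔭 ≤
              lengthAt (IwasawaAlgebra 2) (IwasawaAlgebra 2 ⧸ Ideal.span {kobayashiL 1 Lplus Lminus}) 𝔭) := by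
  intro hK2 hRK hR W _ _ hcm hr hss ha κ γ hκ hγ hcv _ f hf ϖ hϖ Lplus Lminus hPP D hX 𝔭 h𝔭 hp𝔭
  haveI : ContinuousSMul ℤ_[2] (W.tateModule 2) := TateModule.continuousSMul_padicInt
  haveI : Module.Free ℤ_[2] (W.tateModule 2) := module_free_tateModule_holds W 2
  haveI : Module.Finite ℤ_[2] (W.tateModule 2) := module_finite_tateModule_holds W 2
  -- the place of `ℚ` above `2`
  have hv : ((2 : ℕ) : 𝓞 ℚ) ∈
      ((Rat.HeightOneSpectrum.primesEquiv (R := 𝓞 ℚ)).symm ⟨2, Nat.prime_two⟩).asIdeal :=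
    (natCast_mem_asIdeal_iff_eq_primesEquiv_symm _ Nat.prime_two).mpr rfl
  -- the involution as a ring automorphism, and the twisted prime `𝔮 = ι𝔭`
  let ιe : IwasawaAlgebra 2 ≃+* IwasawaAlgebra 2 := (IwasawaAlgebra.involEquiv 2 : IwasawaAlgebra 2 ≃+* IwasawaAlgebra 2)
  set 𝔮 : PrimeSpectrum (IwasawaAlgebra 2) := PrimeSpectrum.comap (IwasawaAlgebra.invol 2).toRingHom 𝔭 with h𝔮def
  have h𝔮𝔭 : 𝔮.asIdeal = 𝔭.asIdeal.comap ιe := IwasawaInvolution.ideal_comap_invol_toRingHom 2 𝔭.asIdeal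
  have h𝔮 : 𝔮.asIdeal.height = 1 := by rw [h𝔮def, IwasawaInvolution.height_comap_invol, h𝔭]
  have hp𝔮 : PowerSeries.C (2 : ℤ_[2]) ∉ 𝔮.asIdeal := fun h ↦
    hp𝔭 ((IwasawaInvolution.C_mem_comap_invol_iff 2 (2 : ℤ_[2]) 𝔭).mp h)
  -- the ι-repaired package AT `𝔮`
  obtain ⟨I, P, _, _, ιP, col, j, s, m, hj, hι, hcj, hloc, hES, hdiv⟩ :=
    hR _ hv W hcm hr hss ha κ γ hκ hγ hcv f hf ϖ hϖ Lplus Lminus hPP D hX 𝔮 h𝔮 hp𝔮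
  have hL : kobayashiL 1 Lplus Lminus ≠ 0 := by rw [kobayashiL, if_pos rfl]; exact hPP.2.1
  have hcs : ιP (col s) ≠ 0 := ne_zero_of_lengthAt_quotient_span_le hL 𝔮 h𝔮 hdiv
  have hs0 : s ≠ 0 := by
    rintro rfl
    exact hcs (by rw [map_zero, map_zero])
  -- (RK⁺) on this habitat datum and its newform: `rank_Λ 𝐇¹ ≤ 1` — the socket replacing GZK
  have hrk : Module.rank (IwasawaAlgebra 2) I.H ≤ 1 := hRK W hcm hr hss ha κ γ hκ hγ f hf I
  have hinj := injective_col_of_rank_le_one hγ I hrk ιP col hcs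
  have hfin := lengthAt_quotient_span_ne_top_of_rank_le_one hκ hγ I hrk hs0 𝔮 (le_of_eq h𝔮)
  -- the canonical fine dual and the kernel-built restriction `k : X⁺ ↠ X₀`
  let Y : W.FineSelmerDualData κ γ := W.fineSelmerDualData κ hγ
  obtain ⟨k, -, -, hkker, -⟩ := FineRestriction.exists_fineRestrict_package W κ hγ D Y
  -- (K2^ι) at `𝔭`: `ℓ_𝔭(X₀) ≤ ℓ_𝔮(𝐇¹/Λs)`
  have hK := hK2 W hcm κ γ hκ hγ I Y s ((Kato2004.isEulerSystemClassTwo_iff W hκ I s).mp hES) hs0 𝔭 h𝔭 hp𝔭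
  have hu𝔮 : (PowerSeries.C (2 : ℤ_[2]) : IwasawaAlgebra 2) ^ (m + 1) ∉ 𝔮.asIdeal :=
    pow_not_mem_of_not_mem 𝔮 hp𝔮 (m + 1)
  have hu𝔭 : (PowerSeries.C (2 : ℤ_[2]) : IwasawaAlgebra 2) ^ (m + 1) ∉ 𝔭.asIdeal :=
    pow_not_mem_of_not_mem 𝔭 hp𝔭 (m + 1)
  -- cover of `ker k` with exponent `m + 1`: fine sandwich + (LocCover) at the prime of `ℚ_∞` above `2`, at `2 • x`
  have hjk : ∀ x : D.X, k x = 0 →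
      ∃ y : P, j y = (PowerSeries.C (2 : ℤ_[2]) : IwasawaAlgebra 2) ^ (m + 1) • x := by
    intro x hxk
    rw [C_two_pow_succ_smul]
    refine FineStrictRat.localCover_of_localCover_resOfLe_rat W κ 1 hκ _ hv D (2 • x) (hloc (2 • x))
      fun t ht ↦ ?_
    exact FineSandwich.toDual_two_nsmul_apply_eq_zero W κ 1 D x ((hkker x).1 hxk) t ht
  -- the semilinear four-term inequality with `σ = ι`, `R`-side prime `𝔮`, `S`-side prime `𝔭`
  have h4 := fourTerm_lengthAt_le_upTo_semilinear ιe h𝔮𝔭 ιP col j (fun g y ↦ hj g y) k hu𝔮 hu𝔭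
    (fun y hy ↦ C_two_pow_succ_smul_eq_zero (hι y hy))
    (fun x hx ↦ by rw [hinj (hx.trans (map_zero col).symm), smul_zero])
    (fun x ↦ C_two_pow_succ_smul_eq_zero (hcj x)) hjk s
  -- the zeta bound at `𝔮`, the functional equation, and cancellation of the finite `ℓ_𝔮(𝐇¹/Λs)`
  have hFE := IwasawaInvolution.lengthAt_quotient_kobayashiL_comap_invol_eq hf hss ha hPP 𝔭
  have h : lengthAt (IwasawaAlgebra 2) D.X 𝔭 +
        lengthAt (IwasawaAlgebra 2) (I.H ⧸ Submodule.span (IwasawaAlgebra 2) {s}) 𝔮 ≤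
      lengthAt (IwasawaAlgebra 2) (IwasawaAlgebra 2 ⧸ Ideal.span {kobayashiL 1 Lplus Lminus}) 𝔭 +
        lengthAt (IwasawaAlgebra 2) (I.H ⧸ Submodule.span (IwasawaAlgebra 2) {s}) 𝔮 :=
    h4.trans ((add_le_add hK (hdiv.trans (le_of_eq hFE))).trans (le_of_eq (add_comm _ _)))
  exact (WithTop.add_le_add_iff_right hfin).mp h

namespace KatoBK

/-! ## §1 K3 BY NAME over the socket: {13.4 (2)@2-contra, (RK⁺) / (RK), fact} -/

/-- **K3 (TP2 decl `SignedKatoDivisibilityUpToAtTwo`, item stmt-BirchSwinnertonDyer-20308) ⟸ {Kato Thm. 13.4 (2) at `2`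
(contragredient fine dual), (RK⁺) «`rank_Λ 𝐇¹_Γ(T₂W) ≤ 1` for every habitat `W` with its newform, the cyclotomic `κ`, `γ`, every
pin `I`», Kato's `2`-adic zeta-value / Tate-pairing package}** — MASTER certificate over the socket. The line's landed road with the
GZK binder replaced by (RK⁺): `signedKatoDivisibilityUpToAtTwo_of_offTwo ∘ stub_involChainTwo_of_rankLeOneNewform ∘
katoBoundTwoInv_of_contra`, the package (R2^ι) produced from the fact through `coreKZ_of_coreKZLit`, the CORE_KZ socket with the four
kernel bricks, `CoreChi.corePairChi_of_corePairChiPrim`, `CoreChi.core_of_corePairChi`, `NoPTOfCore.layerSideNoPTTwo_of_core`,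
`OfPubCore.layerSideTwoInv_of_ptOrth_of_noPT LayerPTFinal.stub_ptOrthLayerTwo`, `h1SideTwoInv_of_layerSideTwoInv`,
`localRobustPackageTwoInv_of_h1SideTwoInv`. CONDITIONAL on the three displayed hypotheses; closes nothing by itself; BSD is not
proved by this. [cite: Kato2004Asterisque, Thm. 13.4 (2) (p. 226), Thm. 12.5 (1) (pp. 221–222), Ex. 13.3 (p. 225), §17.13 (p. 279)]
[cite: Kobayashi2003, Thm. 6.3 (p. 11), (8.23), (8.29), Prop. 8.25] [cite: Rubin1998Durham, §5 display (2), Thm. 7.1] -/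
theorem signedKatoDivisibilityUpToAtTwo_of_contraFact_of_rankLeOneNewform_of_kato_tatePairing_fact
    (hK2 : Kato2004.thm13_4_two_lengthAt_fineSelmerDualContra_le_of_isEulerSystemClassTwo)
    (hRK : ∀ (W : WeierstrassCurve ℚ) [W.IsElliptic] [W.IsGloballyMinimal],
      ¬ W.HasCM → W.analyticRank = 0 → GoodSS W 2 → W.frobeniusTrace 2 = 0 →
      ∀ [ContinuousSMul ℤ_[2] (W.tateModule 2)] (κ : ZpExtension ℚ 2) (γ : Field.absoluteGaloisGroup ℚ),
        κ.IsCyclotomic → κ.IsTopGenerator γ →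
        ∀ [NeZero (W.conductorNorm ℤ)] (f : CuspForm (Gamma0 (W.conductorNorm ℤ)) 2), IsNewformOf W f →
        ∀ I : Kato2004.IwasawaH1Data W 2 κ γ, Module.rank (IwasawaAlgebra 2) I.H ≤ 1)
    (hF : Kato2004.exists_eulerSystem_expStar_tatePairing_values_two) :
    Summit.BirchSwinnertonDyer.BirchSwinnertonDyer.Theses.ThetaPartnerAtTwo.SignedKatoDivisibilityUpToAtTwo :=
  signedKatoDivisibilityUpToAtTwo_of_offTwo
    (stub_involChainTwo_of_rankLeOneNewform (IwasawaInvolution.katoBoundTwoInv_of_contra hK2) hRK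
      (localRobustPackageTwoInv_of_h1SideTwoInv
        (h1SideTwoInv_of_layerSideTwoInv
          (OfPubCore.layerSideTwoInv_of_ptOrth_of_noPT LayerPTFinal.stub_ptOrthLayerTwo
            (NoPTOfCore.layerSideNoPTTwo_of_core
              (CoreChi.core_of_corePairChi
                (CoreChi.corePairChi_of_corePairChiPrim
                  (corePairChiPrim_of_coreKZ_of_bricks (coreKZ_of_coreKZLit hF) cuspBrick_unconditional
                    heckeBaseTwo_brick logBaseTwo_brick katoTrivialValuesTwo_brick))))))))


/-- **K3 (TP2 decl `SignedKatoDivisibilityUpToAtTwo`, item stmt-BirchSwinnertonDyer-20308) ⟸ {Kato Thm. 13.4 (2) at `2`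
(contragredient fine dual, `Kato2004.thm13_4_two_lengthAt_fineSelmerDualContra_le_of_isEulerSystemClassTwo`), (RK) the habitat
rank statement «`rank_Λ 𝐇¹_Γ(T₂W) ≤ 1` for every habitat `W`, the cyclotomic `κ`, `γ`, every pin `I`», Kato's `2`-adic
zeta-value / Tate-pairing package (`Kato2004.exists_eulerSystem_expStar_tatePairing_values_two`)}.** The line's landed road with
the GZK binder replaced by (RK): `signedKatoDivisibilityUpToAtTwo_of_offTwo ∘ stub_involChainTwo_of_rankLeOne ∘
katoBoundTwoInv_of_contra`, the package (R2^ι) produced from the fact through `coreKZ_of_coreKZLit`, the CORE_KZ socket with the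
four kernel bricks, `CoreChi.corePairChi_of_corePairChiPrim`, `CoreChi.core_of_corePairChi`, `NoPTOfCore.layerSideNoPTTwo_of_core`,
`OfPubCore.layerSideTwoInv_of_ptOrth_of_noPT LayerPTFinal.stub_ptOrthLayerTwo`, `h1SideTwoInv_of_layerSideTwoInv`,
`localRobustPackageTwoInv_of_h1SideTwoInv`. CONDITIONAL on the three displayed hypotheses; closes nothing by itself; BSD is not
proved by this. [cite: Kato2004Asterisque, Thm. 13.4 (2) (p. 226), Thm. 12.5 (1) (pp. 221–222), Ex. 13.3 (p. 225), §17.13 (p. 279)]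
[cite: Kobayashi2003, Thm. 6.3 (p. 11), (8.23), (8.29), Prop. 8.25] [cite: Rubin1998Durham, §5 display (2), Thm. 7.1] -/
theorem signedKatoDivisibilityUpToAtTwo_of_contraFact_of_rankLeOne_of_kato_tatePairing_fact
    (hK2 : Kato2004.thm13_4_two_lengthAt_fineSelmerDualContra_le_of_isEulerSystemClassTwo)
    (hRK : ∀ (W : WeierstrassCurve ℚ) [W.IsElliptic] [W.IsGloballyMinimal],
      ¬ W.HasCM → W.analyticRank = 0 → GoodSS W 2 → W.frobeniusTrace 2 = 0 →
      ∀ [ContinuousSMul ℤ_[2] (W.tateModule 2)] (κ : ZpExtension ℚ 2) (γ : Field.absoluteGaloisGroup ℚ),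
        κ.IsCyclotomic → κ.IsTopGenerator γ →
        ∀ I : Kato2004.IwasawaH1Data W 2 κ γ, Module.rank (IwasawaAlgebra 2) I.H ≤ 1)
    (hF : Kato2004.exists_eulerSystem_expStar_tatePairing_values_two) :
    Summit.BirchSwinnertonDyer.BirchSwinnertonDyer.Theses.ThetaPartnerAtTwo.SignedKatoDivisibilityUpToAtTwo :=
  signedKatoDivisibilityUpToAtTwo_of_offTwo
    (stub_involChainTwo_of_rankLeOne (IwasawaInvolution.katoBoundTwoInv_of_contra hK2) hRK
      (localRobustPackageTwoInv_of_h1SideTwoInv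
        (h1SideTwoInv_of_layerSideTwoInv
          (OfPubCore.layerSideTwoInv_of_ptOrth_of_noPT LayerPTFinal.stub_ptOrthLayerTwo
            (NoPTOfCore.layerSideNoPTTwo_of_core
              (CoreChi.core_of_corePairChi
                (CoreChi.corePairChi_of_corePairChiPrim
                  (corePairChiPrim_of_coreKZ_of_bricks (coreKZ_of_coreKZLit hF) cuspBrick_unconditional
                    heckeBaseTwo_brick logBaseTwo_brick katoTrivialValuesTwo_brick))))))))

/-! ## §2 The KATO-2004-ONLY readings: K3 ⟸ {Kato 13.4 (2)@2, Kato Cor. 14.3@2 (bsd.S20), Kato 12.5-package} and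
K3 ⟸ {Kato 13.4 (2)@2, Kato 12.4, Kato 12.5-package} -/

/-- **K3 BY NAME ⟸ THREE NAMED THEOREMS OF KATO, Astérisque 295 (2004), AND NOTHING ELSE — the rank-zero reading:** Thm. 13.4 (2)
at `p = 2` (`Kato2004.thm13_4_two_lengthAt_fineSelmerDualContra_le_of_isEulerSystemClassTwo`), Cor. 14.3 / Thm. 14.2 at the trivial
character over `ℚ` at `p = 2` (bsd.S20 `kato_finite_of_L_one_ne_zero W 2`: `L(E, 1) ≠ 0 ⇒ E(ℚ)`, `Ш[2^∞]`, `Sel_{2^∞}(E/ℚ)` finite),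
and Thm. 12.5 (1) with (8.1.3)/Ex. 13.3 read on the layer Tate pairing at `2` (`Kato2004.exists_eulerSystem_expStar_tatePairing_values_two`).
No Gross–Zagier, no Kolyvagin: the chain uses GZK only as (RK⁺), and on the habitat (RK⁺) ⟸ bsd.S20 — the newform `f` of `W` makes
`L(E, s)` entire (`hasEntireLFunction_of_cuspCoeff_eq`, Hecke), so `r_an(W) = 0` gives `L(E, 1) ≠ 0` (`analyticRank_eq_zero_iff_holds`),
bsd.S20 gives `Sel_{2^∞}(E/ℚ)` finite, and `rank_iwasawaH1_le_one_of_finite_selmerGroupPInfty` (Kato 14.5 (1)/14.13 ⇒ (R0) ⇒ 12.4 (2)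
upper half, tree theorems) gives the rank. All three hypotheses are EXISTING Literature `def … : Prop` facts (none proved in the
tree); CONDITIONAL; closes nothing by itself; BSD is not proved by this.
[cite: Kato2004Asterisque, Thm. 12.5 (1) (pp. 221–222), Thm. 13.4 (2) (p. 226), Thm. 14.2 and Cor. 14.3 (p. 235), Thm. 14.5 (1) (p. 236)]
[cite: Kobayashi2003, Thm. 6.3 (p. 11), Prop. 8.25] [cite: Rubin1998Durham, Thm. 7.1] [cite: BirchSwinnertonDyer1965] -/
theorem signedKatoDivisibilityUpToAtTwo_of_kato2004_cor143_facts
    (hK2 : Kato2004.thm13_4_two_lengthAt_fineSelmerDualContra_le_of_isEulerSystemClassTwo)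
    (hS20 : ∀ (W : WeierstrassCurve ℚ) [W.IsElliptic], kato_finite_of_L_one_ne_zero W 2)
    (hF : Kato2004.exists_eulerSystem_expStar_tatePairing_values_two) :
    Summit.BirchSwinnertonDyer.BirchSwinnertonDyer.Theses.ThetaPartnerAtTwo.SignedKatoDivisibilityUpToAtTwo :=
  signedKatoDivisibilityUpToAtTwo_of_contraFact_of_rankLeOneNewform_of_kato_tatePairing_fact hK2
    (fun W _ _ _ hr _ _ _ _ _ hκ hγ _ f hf I ↦ by
      have hE : W.HasEntireLFunction := W.hasEntireLFunction_of_cuspCoeff_eq (strictWidthInfty_Gamma0 _) f hf.2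
      have hL : W.entireLFunction 1 ≠ 0 := (WeierstrassCurve.analyticRank_eq_zero_iff_holds (W := W) hE).mp hr
      haveI : Finite (W.selmerGroupPInfty 2) := (hS20 W hL).2.2
      exact rank_iwasawaH1_le_one_of_finite_selmerGroupPInfty hκ hγ I) hF


/-- **K3 BY NAME ⟸ THREE NAMED THEOREMS OF KATO, Astérisque 295 (2004), AND NOTHING ELSE:** Thm. 13.4 (2) at `p = 2`
(`Kato2004.thm13_4_two_lengthAt_fineSelmerDualContra_le_of_isEulerSystemClassTwo`), Thm. 12.4 (2) (`Kato2004.thm12_4`: `𝐇¹_Γ(T_pW)`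
torsion free of `Λ`-rank `1`, every `p`), and Thm. 12.5 (1) with (8.1.3)/Ex. 13.3 read on the layer Tate pairing at `2`
(`Kato2004.exists_eulerSystem_expStar_tatePairing_values_two`). No Gross–Zagier, no Kolyvagin: the chain uses GZK only as (RK), and
(RK) ⟸ Thm. 12.4 (2) (`rank_iwasawaH1_le_one_of_thm12_4`). All three hypotheses are EXISTING Literature `def … : Prop` facts
(none proved in the tree; `thm12_4` was typed by cell `bsd-cn100`); CONDITIONAL; closes nothing by itself; BSD is not proved by
this. [cite: Kato2004Asterisque, Thm. 12.4 (2) (p. 221), Thm. 12.5 (1) (pp. 221–222), Thm. 13.4 (2) (p. 226)]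
[cite: Kobayashi2003, Thm. 6.3 (p. 11), Prop. 8.25] [cite: Rubin1998Durham, Thm. 7.1] -/
theorem signedKatoDivisibilityUpToAtTwo_of_kato2004_facts
    (hK2 : Kato2004.thm13_4_two_lengthAt_fineSelmerDualContra_le_of_isEulerSystemClassTwo)
    (h124 : Kato2004.thm12_4)
    (hF : Kato2004.exists_eulerSystem_expStar_tatePairing_values_two) :
    Summit.BirchSwinnertonDyer.BirchSwinnertonDyer.Theses.ThetaPartnerAtTwo.SignedKatoDivisibilityUpToAtTwo :=
  signedKatoDivisibilityUpToAtTwo_of_contraFact_of_rankLeOne_of_kato_tatePairing_fact hK2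
    (fun _ _ _ _ _ _ _ _ _ _ hκ hγ I ↦ rank_iwasawaH1_le_one_of_thm12_4 h124 hκ hγ I) hF

/-! ## §3 The `Sel_{2^∞}(E/ℚ)`-finite reading: K3 ⟸ {13.4 (2)@2-contra, (SEL), fact} -/

/-- **K3 BY NAME ⟸ {Kato Thm. 13.4 (2) at `2`, (SEL) «`Sel_{2^∞}(W/ℚ)` is finite for every habitat curve `W`», Kato's
`2`-adic zeta-value / Tate-pairing package}.** (SEL) is exactly what Gross–Zagier–Kolyvagin supplies in analytic rank `0`
(`W(ℚ)` and `Ш(W)` finite) and what Kato's own Cor. 14.3 (1) / Thm. 14.2 asserts at `L(E, 1) ≠ 0`; (RK) ⟸ (SEL) is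
`rank_iwasawaH1_le_one_of_finite_selmerGroupPInfty` (Kato 14.5 (1)/14.13 ⇒ (R0) ⇒ 12.4 (2) upper half, all tree theorems).
CONDITIONAL; closes nothing by itself; BSD is not proved by this. [cite: Kato2004Asterisque, Thm. 13.4 (2) (p. 226), Cor. 14.3 (1) (p. 235), Thm. 14.5 (1) (p. 236)]
[cite: Darmon2004, Thm. 3.22] -/
theorem signedKatoDivisibilityUpToAtTwo_of_contraFact_of_finiteSelmer_of_kato_tatePairing_fact
    (hK2 : Kato2004.thm13_4_two_lengthAt_fineSelmerDualContra_le_of_isEulerSystemClassTwo)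
    (hSel : ∀ (W : WeierstrassCurve ℚ) [W.IsElliptic] [W.IsGloballyMinimal],
      ¬ W.HasCM → W.analyticRank = 0 → GoodSS W 2 → W.frobeniusTrace 2 = 0 → Finite (W.selmerGroupPInfty 2))
    (hF : Kato2004.exists_eulerSystem_expStar_tatePairing_values_two) :
    Summit.BirchSwinnertonDyer.BirchSwinnertonDyer.Theses.ThetaPartnerAtTwo.SignedKatoDivisibilityUpToAtTwo :=
  signedKatoDivisibilityUpToAtTwo_of_contraFact_of_rankLeOne_of_kato_tatePairing_fact hK2
    (fun W _ _ hcm hr hss ha _ _ _ hκ hγ I ↦ by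
      haveI : Finite (W.selmerGroupPInfty 2) := hSel W hcm hr hss ha
      exact rank_iwasawaH1_le_one_of_finite_selmerGroupPInfty hκ hγ I) hF

/-! ## §4 The two Kato-only certificates read on the RTT decl (`route-BirchSwinnertonDyer-ResidualThetaTransportAtTwo`) -/

/-- RTT reading of `signedKatoDivisibilityUpToAtTwo_of_kato2004_cor143_facts`: K3 (RTT decl) ⟸ {Kato 13.4 (2)@2, Kato Cor. 14.3@2
(bsd.S20), Kato 12.5-package}, no Gross–Zagier–Kolyvagin. CONDITIONAL; closes nothing by itself; BSD is not proved by this.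
[cite: Kato2004Asterisque, Thm. 13.4 (2) (p. 226), Cor. 14.3 (p. 235), Thm. 12.5 (1) (pp. 221–222)] -/
theorem signedKatoDivisibilityUpToAtTwo_rtt_of_kato2004_cor143_facts
    (hK2 : Kato2004.thm13_4_two_lengthAt_fineSelmerDualContra_le_of_isEulerSystemClassTwo)
    (hS20 : ∀ (W : WeierstrassCurve ℚ) [W.IsElliptic], kato_finite_of_L_one_ne_zero W 2)
    (hF : Kato2004.exists_eulerSystem_expStar_tatePairing_values_two) :
    Summit.BirchSwinnertonDyer.BirchSwinnertonDyer.Theses.ResidualThetaTransportAtTwo.SignedKatoDivisibilityUpToAtTwo :=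
  signedKatoDivisibilityUpToAtTwo_of_kato2004_cor143_facts hK2 hS20 hF

/-- RTT reading of `signedKatoDivisibilityUpToAtTwo_of_kato2004_facts`: K3 (RTT decl) ⟸ {Kato 13.4 (2)@2, Kato 12.4, Kato
12.5-package}, no Gross–Zagier–Kolyvagin. CONDITIONAL; closes nothing by itself; BSD is not proved by this.
[cite: Kato2004Asterisque, Thm. 12.4 (2) (p. 221), Thm. 12.5 (1) (pp. 221–222), Thm. 13.4 (2) (p. 226)] -/
theorem signedKatoDivisibilityUpToAtTwo_rtt_of_kato2004_facts
    (hK2 : Kato2004.thm13_4_two_lengthAt_fineSelmerDualContra_le_of_isEulerSystemClassTwo)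
    (h124 : Kato2004.thm12_4)
    (hF : Kato2004.exists_eulerSystem_expStar_tatePairing_values_two) :
    Summit.BirchSwinnertonDyer.BirchSwinnertonDyer.Theses.ResidualThetaTransportAtTwo.SignedKatoDivisibilityUpToAtTwo :=
  signedKatoDivisibilityUpToAtTwo_of_kato2004_facts hK2 h124 hF

end KatoBK

end Summit.BirchSwinnertonDyer.BirchSwinnertonDyer.Theorems.SignedKatoOffTwo

end
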